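import Summits.CriticalPhenomena.PercolationContinuityZ3.Theorems.Transplant.GrigorchukWitnessNearCriticalLRODefs
import Summits.CriticalPhenomena.PercolationContinuityZ3.Theorems.Transplant.GrigorchukWitnessConj4Defs
import Summits.CriticalPhenomena.PercolationContinuityZ3.Theorems.Transplant.GrigorchukCayleyLabelRigidity
import Summits.CriticalPhenomena.PercolationContinuityZ3.Theorems.Transplant.GrigorchukTimesZCayleyClasses
import Summits.CriticalPhenomena.PercolationContinuityZ3.Theorems.Transplant.GrigorchukSuperpolynomialGrowth
import Literature.GroupTheory.Nilpotent.GrowthFiniteIndexTransfer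
import HarnessLib

/-!
# The two Grigorchuk witnesses satisfy the hypotheses of the snowballing bridge: `Cay(𝔊; a,b,c,d)` is 4-regular, `Cay(𝔊 × ℤ; a,b,c,d,z)` is
# 6-regular, both are vertex-transitive, connected and amenable — so Easo–Hutchcroft's printed Prop. 4.1 (15), taken as a HYPOTHESIS, gives
# `SnowballStep stdCay 4` and `SnowballStep gzCay 6`; and `Cay(𝔊; a,b,c,d)` has stretched-exponential growth `GrowthLower` (kernel, from the
# squaring inequality)

Proof file (`--supports stmt-CriticalPhenomena-4575`), lane `prim-bschramm`, seat `prim-bschramm-gen-1` gen 11 (GEN pen), lead g28's :498 STEP 1b (the inputs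
STEP 2 starts from).  builds on p205010 (kernel theorem, internal audit signed; external expert review pending) — nothing in this file uses p205010.  Def-free; no
instance, no notation, no sorry, no `@[conjecture]`; nothing about `θ(p_c)`: `Grigorchuk.stdCay_conj4` / `Grigorchuk.gzCay_conj4`, the residue node and Conjecture 4
stay OPEN and are not mentioned by any declaration.  Easo–Hutchcroft's proposition `EasoHutchcroft2023_snowballing` is a HYPOTHESIS of the two instance theorems,
never asserted.

CONTENT:
* §1 `isGraphTransitive_mulCayley` — every right Cayley graph `Cay(Γ; S)` is vertex-transitive (left multiplications, «CayleySkeletonSign» `leftMulIso`).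
* §2 `Grigorchuk.toG_injective`, **`Grigorchuk.stdCay_degree : stdCay.degree u = 4`** (the four letters `a, b, c, d` are distinct non-identity involutions; neighbours
  = `u·{a,b,c,d}`, «GrigorchukCayleyLabelRigidity» `stdCay_adj_iff`); `Grigorchuk.toP_injective`, **`Grigorchuk.gzCay_degree : gzCay.degree u = 6`** (neighbours =
  `u·{a,b,c,d,z,z⁻¹}`, «GrigorchukTimesZCayleyClasses» `gzCay_adj_iff`).
* §3 **`Grigorchuk.stdCay_snowballStep (hEH) : SnowballStep stdCay 4`**, **`Grigorchuk.gzCay_snowballStep (hEH) : SnowballStep gzCay 6`** — the bridge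
  `SnowballSqueeze.snowballStep_of_snowballing` fed with: connected (`CayleyScaled.connected_mulCayley_of_closure`, kernel), transitive (§1), amenable
  («GrigorchukSubexponentialGrowth» `isGraphAmenable_cayley`, «GrigorchukTimesZResidueScope» `gzCay_isGraphAmenable`, kernel), regular (§2).
* §4 **`Grigorchuk.stdCay_growthLower : ∃ a > 0, ∀ v, GrowthLower stdCay v a`** — stretched-exponential growth of `Cay(𝔊; a,b,c,d)` with SOME exponent `a > 0`
  (kernel: «GrigorchukSuperpolynomialGrowth» `card_wordBall_sq_le` + `iterate_sq`: `|B(n_k)| ≥ 2^(2^k)` along `n_k ≤ M^k n₀`, hence `|B(m)| ≥ exp(c·m^a)` with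
  `a = log 2 / log M`; NO numerical value of `a` is typed — in print `a ↑ 0.7674`, Erschler–Zheng 2020, not used).
[cite: EasoHutchcroft2023, Prop. 4.1 (15)] [cite: Grigorchuk1984, Thm. (lower bound)] [cite: BenjaminiSchramm1996, §2 (Cayley graphs)]
-/

noncomputable section

namespace Summit.CriticalPhenomena.PercolationContinuityZ3.Theorems.Transplant

open SimpleGraph Filter Literature.Barriers.CriticalPhenomena Literature.Probability.Percolation Literature.Probability.Percolation.Snowballing
  SnowballSqueeze
open scoped Classical Topology

/-! ## §1 Cayley graphs are vertex-transitive -/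

/-- **Every right Cayley graph `Cay(Γ; S)` is vertex-transitive**: `w ↦ (y x⁻¹)·w` is an automorphism taking `x` to `y`. [cite: BenjaminiSchramm1996, §2 (Cayley graphs are transitive)] -/
theorem isGraphTransitive_mulCayley {Γ : Type} [Group Γ] (S : Finset Γ) : IsGraphTransitive (mulCayley (↑S : Set Γ)) :=
  fun x y => ⟨leftMulIso S (y * x⁻¹), by rw [leftMulIso_apply, inv_mul_cancel_right]⟩

namespace Grigorchuk

/-! ## §2 Degrees: `Cay(𝔊; a,b,c,d)` is 4-regular, `Cay(𝔊 × ℤ; a,b,c,d,z)` is 6-regular -/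

/-- The four letters name four DISTINCT elements `a, b, c, d` of `𝔊` (separated by the finite model). [cite: Grigorchuk1980, definition of a, b, c, d] -/
theorem toG_injective : Function.Injective Letter.toG := by
  intro y y' h
  by_contra hne
  have key : prodG [y] ≠ prodG [y'] := prodG_ne_of_sep (by
    revert hne
    rcases y with _ | ⟨_ | _ | _⟩ <;> rcases y' with _ | ⟨_ | _ | _⟩ <;> intro hne <;> first | exact absurd rfl hne | decide)
  exact key (by simp only [prodG, mul_one, h])

/-- **`Cay(𝔊; a, b, c, d)` is 4-regular**: the neighbours of `u` are `u·a, u·b, u·c, u·d`, pairwise distinct. [cite: BenjaminiSchramm1996, §2 (Cayley graphs)] -/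
theorem stdCay_degree (u : ↥grigorchukGroup) : stdCay.degree u = 4 := by
  have hset : stdCay.neighborFinset u = ({Letter.a, .x .b, .x .c, .x .d} : Finset Letter).image (fun y => u * Letter.toG y) := by
    ext w
    rw [mem_neighborFinset, stdCay_adj_iff, Finset.mem_image]
    constructor
    · rintro ⟨y, rfl⟩
      exact ⟨y, by rcases y with _ | ⟨_ | _ | _⟩ <;> simp, rfl⟩
    · rintro ⟨y, -, rfl⟩
      exact ⟨y, rfl⟩
  rw [← card_neighborFinset_eq_degree, hset, Finset.card_image_of_injective _ (fun y y' h => toG_injective (mul_left_cancel h))]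
  decide

/-- The six codes name six DISTINCT elements `a, b, c, d, z, z⁻¹` of `𝔊 × ℤ` (separated by lamp sums and the finite model). [folklore] -/
theorem toP_injective : Function.Injective L6.toP := by
  intro y y' h
  by_contra hne
  have key : prodP [y] ≠ prodP [y'] := prodP_ne_of_sep (by
    revert hne
    cases y <;> cases y' <;> intro hne <;> first | exact absurd rfl hne | decide)
  exact key (by simp only [prodP, mul_one, h])

/-- **`Cay(𝔊 × ℤ; a, b, c, d, z)` is 6-regular**: the neighbours of `u` are `u·a, u·b, u·c, u·d, u·z, u·z⁻¹`, pairwise distinct. [cite: BenjaminiSchramm1996, §2 (Cayley graphs)] -/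
theorem gzCay_degree (u : GZ) : gzCay.degree u = 6 := by
  have hset : gzCay.neighborFinset u = ({L6.a, .b, .c, .d, .s, .si} : Finset L6).image (fun y => u * L6.toP y) := by
    ext w
    rw [mem_neighborFinset, gzCay_adj_iff, Finset.mem_image]
    constructor
    · rintro ⟨y, rfl⟩
      exact ⟨y, by cases y <;> simp, rfl⟩
    · rintro ⟨y, -, rfl⟩
      exact ⟨y, rfl⟩
  rw [← card_neighborFinset_eq_degree, hset, Finset.card_image_of_injective _ (fun y y' h => toP_injective (mul_left_cancel h))]
  decide

/-! ## §3 The witnesses satisfy `SnowballStep`, modulo Easo–Hutchcroft's printed Prop. 4.1 (15) (a hypothesis) -/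

/-- **`SnowballStep stdCay 4` ⟸ Easo–Hutchcroft Prop. 4.1 (15)** (`hEH` a HYPOTHESIS, never asserted): `Cay(𝔊; a,b,c,d)` is connected, vertex-transitive, amenable and
4-regular, so the kernel bridge applies (unimodularity and uniqueness at every `p` are kernel theorems inside the bridge). [cite: EasoHutchcroft2023, Prop. 4.1 (15), Remark 4.1] -/
theorem stdCay_snowballStep (hEH : EasoHutchcroft2023_snowballing) : SnowballStep stdCay 4 :=
  snowballStep_of_snowballing hEH stdCay (CayleyScaled.connected_mulCayley_of_closure _ closure_gens_finset) (isGraphTransitive_mulCayley _)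
    isGraphAmenable_cayley (by norm_num) stdCay_degree

/-- **`SnowballStep gzCay 6` ⟸ Easo–Hutchcroft Prop. 4.1 (15)** (`hEH` a HYPOTHESIS): `Cay(𝔊 × ℤ; a,b,c,d,z)` is connected, vertex-transitive, amenable and 6-regular.
[cite: EasoHutchcroft2023, Prop. 4.1 (15), Remark 4.1] -/
theorem gzCay_snowballStep (hEH : EasoHutchcroft2023_snowballing) : SnowballStep gzCay 6 :=
  snowballStep_of_snowballing hEH gzCay gzCay_connected (isGraphTransitive_mulCayley _) gzCay_isGraphAmenable (by norm_num) gzCay_degree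

/-! ## §4 Stretched-exponential growth of `Cay(𝔊; a,b,c,d)` with SOME exponent (kernel; no numerical exponent typed) -/

/-- Real bookkeeping for the growth lower bound: if `q < M^(k+1)` with `M ≥ 2`, `q ≥ 1`, then `q^a ≤ 2·2^k` for `a = log 2 / log M`. [folklore] -/
theorem rpow_le_two_mul_two_pow {M q k : ℕ} (hM : 2 ≤ M) (hq : 1 ≤ q) (hlt : q < M ^ (k + 1)) :
    (q : ℝ) ^ (Real.log 2 / Real.log M) ≤ 2 * (2 : ℝ) ^ k := by
  have hM' : (1 : ℝ) < M := by exact_mod_cast (lt_of_lt_of_le one_lt_two hM)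
  have hlogM : 0 < Real.log M := Real.log_pos hM'
  have hq' : (0 : ℝ) < q := by exact_mod_cast (lt_of_lt_of_le zero_lt_one hq)
  have hlog2 : 0 < Real.log 2 := Real.log_pos one_lt_two
  -- `log q < (k+1) log M`
  have h1 : Real.log q < (k + 1 : ℝ) * Real.log M := by
    have h := Real.log_lt_log hq' (show (q : ℝ) < (M : ℝ) ^ (k + 1) by exact_mod_cast hlt)
    rwa [Real.log_pow, Nat.cast_add, Nat.cast_one] at h
  -- `a log q ≤ (k+1) log 2`
  have h2 : Real.log 2 / Real.log M * Real.log q ≤ (k + 1 : ℝ) * Real.log 2 := by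
    rw [div_mul_eq_mul_div, div_le_iff₀ hlogM]
    calc Real.log 2 * Real.log q ≤ Real.log 2 * ((k + 1 : ℝ) * Real.log M) :=
          mul_le_mul_of_nonneg_left h1.le hlog2.le
      _ = (k + 1 : ℝ) * Real.log 2 * Real.log M := by ring
  calc (q : ℝ) ^ (Real.log 2 / Real.log M) = Real.exp (Real.log 2 / Real.log M * Real.log q) := by
        rw [Real.rpow_def_of_pos hq', mul_comm]
    _ ≤ Real.exp ((k + 1 : ℝ) * Real.log 2) := Real.exp_le_exp.2 h2
    _ = 2 * (2 : ℝ) ^ k := by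
        rw [show (k + 1 : ℝ) = ((k + 1 : ℕ) : ℝ) by push_cast; ring, Real.exp_nat_mul, Real.exp_log two_pos, pow_succ]
        ring

/-- **`Cay(𝔊; a, b, c, d)` HAS STRETCHED-EXPONENTIAL GROWTH: `∃ a > 0, ∀ v, GrowthLower stdCay v a`** — i.e. `|B(v, m)| ≥ exp(c·m^a)` for all large `m`,
with SOME exponent `a > 0` (kernel, from Grigorchuk's squaring inequality «GrigorchukSuperpolynomialGrowth» `card_wordBall_sq_le` iterated, `iterate_sq`:
`|B(n_k)| ≥ 2^(2^k)` along `n_k ≤ M^k n₀`, so `|B(m)| ≥ 2^(2^k)` with `M^(k+1) > ⌊m/n₀⌋`, i.e. `2^k ≥ (m/(2n₀))^a / 2`, `a = log 2 / log M`).  NO numerical value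
of `a` is typed (print: `exp(n^{0.5}) ≲ |B(n)|`, Grigorchuk 1984; `a ↑ 0.7674`, Erschler–Zheng 2020 — neither used). [cite: Grigorchuk1984, Thm. (lower bound)] -/
theorem stdCay_growthLower : ∃ a : ℝ, 0 < a ∧ ∀ v : ↥grigorchukGroup, GrowthLower stdCay v a := by
  obtain ⟨T, c, L, hT, hL, hsq⟩ := card_wordBall_sq_le
  obtain ⟨n₀, hn₀, hstart⟩ := exists_card_wordBall_ge (2 * T ^ 2)
  have hit := iterate_sq hT hL hn₀ hstart hsq
  set M : ℕ := 2 * (L * (c + 1)) with hM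
  have hM2 : 2 ≤ M := by rw [hM]; nlinarith
  have hM' : (1 : ℝ) < M := by exact_mod_cast (lt_of_lt_of_le one_lt_two hM2)
  have hlogM : 0 < Real.log M := Real.log_pos hM'
  have hlog2 : 0 < Real.log 2 := Real.log_pos one_lt_two
  set a : ℝ := Real.log 2 / Real.log M with ha
  have ha0 : 0 < a := div_pos hlog2 hlogM
  refine ⟨a, ha0, fun v => ?_⟩
  -- the constant: `c₀ = log 2 / (2 · (2 n₀)^a)`
  have hn₀' : (0 : ℝ) < 2 * n₀ := by
    have : (1 : ℝ) ≤ n₀ := by exact_mod_cast hn₀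
    linarith
  have hpow : 0 < (2 * (n₀ : ℝ)) ^ a := Real.rpow_pos_of_pos hn₀' a
  refine ⟨Real.log 2 / (2 * (2 * (n₀ : ℝ)) ^ a), by positivity, Filter.eventually_atTop.2 ⟨n₀, fun m hm => ?_⟩⟩
  -- the scale `k` with `n_k ≤ m < n₀ M^(k+1)`-ish: `q = ⌊m / n₀⌋`, `k = log_M q`
  set q : ℕ := m / n₀ with hq
  have hq1 : 1 ≤ q := by rw [hq]; exact (Nat.le_div_iff_mul_le (by omega)).2 (by simpa using hm)
  set k : ℕ := Nat.log M q with hk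
  have hMk : M ^ k ≤ q := Nat.pow_log_le_self M (by omega)
  have hqlt : q < M ^ (k + 1) := Nat.lt_pow_succ_log_self (lt_of_lt_of_le one_lt_two hM2) q
  -- (a) the volume: `2^(2^k) ≤ T² 2^(2^k) ≤ |wordBall n_k| ≤ |wordBall m| = |B(v, m)|`
  obtain ⟨h1, -, h3⟩ := hit k
  have hnk_le : (fun j => 2 * (L * (j + c)))^[k] n₀ ≤ m := by
    calc (fun j => 2 * (L * (j + c)))^[k] n₀ ≤ M ^ k * n₀ := h3
      _ ≤ q * n₀ := Nat.mul_le_mul_right _ hMk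
      _ ≤ m := by rw [hq]; exact Nat.div_mul_le_self m n₀
  have hvol : (2 : ℝ) ^ (2 ^ k) ≤ (ballVolume stdCay v m : ℝ) := by
    have hT1 : 1 ≤ T ^ 2 := Nat.one_le_pow _ _ hT
    have hnat : 2 ^ (2 ^ k) ≤ ballVolume stdCay v m := by
      rw [Literature.GroupTheory.Nilpotent.ballVolume_mulCayley_eq, ballVolume_eq_card_wordBall]
      calc 2 ^ (2 ^ k) ≤ T ^ 2 * 2 ^ (2 ^ k) := Nat.le_mul_of_pos_left _ (by positivity)
        _ ≤ (wordBall ((fun j => 2 * (L * (j + c)))^[k] n₀)).card := h1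
        _ ≤ (wordBall m).card := Finset.card_le_card (wordBall_mono hnk_le)
    exact_mod_cast hnat
  -- (b) the exponent: `c₀ m^a ≤ 2^k log 2`
  have hq_ge : (m : ℝ) / (2 * n₀) ≤ q := by
    have hlt : m < q * n₀ + n₀ := by rw [hq]; exact Nat.lt_div_mul_add (by omega)
    have hle : (m : ℝ) ≤ 2 * n₀ * q := by
      have h' : (m : ℝ) < q * n₀ + n₀ := by exact_mod_cast hlt
      have hq1' : (1 : ℝ) ≤ q := by exact_mod_cast hq1
      nlinarith
    rw [div_le_iff₀ hn₀']
    linarith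
  have hqa : ((m : ℝ) / (2 * n₀)) ^ a ≤ (q : ℝ) ^ a := Real.rpow_le_rpow (by positivity) hq_ge ha0.le
  have hma : ((m : ℝ) / (2 * n₀)) ^ a = (m : ℝ) ^ a / (2 * (n₀ : ℝ)) ^ a := Real.div_rpow (Nat.cast_nonneg _) hn₀'.le a
  have h2k : (q : ℝ) ^ a ≤ 2 * (2 : ℝ) ^ k := rpow_le_two_mul_two_pow hM2 hq1 hqlt
  have hexp : Real.log 2 / (2 * (2 * (n₀ : ℝ)) ^ a) * (m : ℝ) ^ a ≤ (2 ^ k : ℕ) * Real.log 2 := by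
    rw [Nat.cast_pow, Nat.cast_ofNat]
    have : (m : ℝ) ^ a / (2 * (n₀ : ℝ)) ^ a ≤ 2 * (2 : ℝ) ^ k := by rw [← hma]; exact hqa.trans h2k
    rw [div_mul_eq_mul_div, div_le_iff₀ (by positivity)]
    have h' : (m : ℝ) ^ a ≤ 2 * (2 : ℝ) ^ k * (2 * (n₀ : ℝ)) ^ a := by rwa [div_le_iff₀ hpow] at this
    nlinarith [hlog2]
  calc Real.exp (Real.log 2 / (2 * (2 * (n₀ : ℝ)) ^ a) * (m : ℝ) ^ a) ≤ Real.exp ((2 ^ k : ℕ) * Real.log 2) := Real.exp_le_exp.2 hexp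
    _ = (2 : ℝ) ^ (2 ^ k) := by rw [Real.exp_nat_mul, Real.exp_log two_pos]
    _ ≤ _ := hvol

end Grigorchuk

end Summit.CriticalPhenomena.PercolationContinuityZ3.Theorems.Transplant
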